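import Literature.NumberTheory.CubicFields.IndexPSubringCount
import Literature.NumberTheory.CubicFields.LocalMaximality
import Literature.NumberTheory.CubicFields.OrbitFiniteness
import Mathlib.Data.Set.Card
import HarnessLib

/-!
# The overring step of the Davenport–Heilbronn uniformity estimates (BST Prop. 23, BTT Lemma 2.3 / §4.2)

Topic `Literature/NumberTheory/CubicFields`; built on `IndexPOverring.lean` (BTT Lemma 2.3 (i): a ring
nonmaximal at `p` with `p ∤ ct` has an index-`p` overring), `IndexPSubringCount.lean` (Lemma 2.3 (ii):
at most `3`, resp. `p + 1`, subrings of index `p`), `LocalMaximality.lean` and `OrbitFiniteness.lean`.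

Bhargava–Shankar–Tsimerman 2013, Prop. 23 ("`N(𝒲_p; X) = O(X/p²)`", rings not maximal at `p`), the
mechanism that Bhargava–Taniguchi–Thorne 2023, §4.2 (Props. 4.5–4.6, "proved in essentially the same
way as [BBP]") iterate over the primes of a squarefree `q`: a cubic ring `R` of discriminant `D` NOT
maximal at `p` is either `ℤ + pR''`, `Disc R'' = D/p⁴`, or has an overring `R'` of index `p`,
`Disc R' = D/p²`, which determines `R` up to `≤ 3` choices if `p ∤ ct(R')` and up to `≤ p + 1` choices
if `R' = ℤ + pS` (`Disc S = D/p⁶`). So in the family of `GL₂(ℤ)`-orbits of forms with `0 < s·Disc < Y`,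
`m² ∣ Disc` (`p ∤ m`), ring maximal at every prime of a finite set `B` — a family stable under these
operations — **the members NONmaximal at `p` number at most `3·N(Y/p²) + (p+1)·N(Y/p⁶) + N(Y/p⁴)`**,
`N(Z)` the size of the family at height `Z`. Everything in this file is PROVED: `MemU.of_injective`
(maximality at `ℓ` passes to overrings); `repOf`, `indexPOrbits k p`, `ncard_indexPOrbits_le` (the
isomorphism classes of index-`p` subrings of `R(k)` number at most `#indexPImages k p`); `InWindow`,
`maxOrbits B s Y m` (finite), `nonmaxOrbits B s Y m p`, `ncard_maxOrbits_eq_add` (the families and the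
split `#maxOrbits B = #maxOrbits (insert p B) + #nonmaxOrbits B … p`); **`ncard_nonmaxOrbits_le`** (the
overring step); and the definitions `stepFactor c p = c + 3 + 1/p² + (p+1)/p⁴`, `MaximalPartBound c C`
(the maximal-at-`B` part, `≤ C c^{#B} X/(∏B)²`) — the per-prime factor and the input SHAPE of the
induction of `UniformityMaximalReductionProofs.lean`, which derives BTT Prop. 4.5 (`btt_uniformity_sqDvd`).

## References

* M. Bhargava, A. Shankar, J. Tsimerman, *On the Davenport–Heilbronn theorems and second order
  terms*, Invent. Math. 193 (2013) 439–499, Prop. 23, Lemma 24 [BhargavaShankarTsimerman2012].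
* M. Bhargava, T. Taniguchi, F. Thorne, *Improved error estimates for the Davenport–Heilbronn
  theorems*, Math. Ann. 389 (2024) = arXiv:2107.12819, Lemma 2.3, §4.2 [BhargavaTaniguchiThorne2023].
* K. Belabas, M. Bhargava, C. Pomerance, *Error estimates for the Davenport–Heilbronn theorems*,
  Duke Math. J. 153 (2010) 173–210 [BelabasBhargavaPomerance2010].
-/

noncomputable section

namespace Literature.NumberTheory.CubicFields

open BinaryCubic RingOfForm

/-! ### Transport of the local conditions, representatives, isomorphism classes of index-`p` subrings -/

namespace BinaryCubic

/-- A `GL₂(ℤ)`-translate of a multiple of `n` is a multiple of `n` (the action is linear in `f`). [folklore] -/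
theorem IsMultiple.of_gl2zEquiv {n : ℤ} {f g : BinaryCubic ℤ} (h : GL2ZEquiv f g) (hf : f.IsMultiple n) :
    g.IsMultiple n := by
  obtain ⟨γ, -, rfl⟩ := h
  obtain ⟨f', rfl⟩ := isMultiple_iff_exists_smul.mp hf
  exact isMultiple_iff_exists_smul.mpr ⟨twist γ f', twist_smul γ n f'⟩

/-- Equivalent forms have equivalent multiples (scaling commutes with the action). [folklore] -/
theorem GL2ZEquiv.smul {f g : BinaryCubic ℤ} (h : GL2ZEquiv f g) (n : ℤ) : GL2ZEquiv (n • f) (n • g) := by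
  obtain ⟨γ, hγ, rfl⟩ := h; exact ⟨γ, hγ, (twist_smul γ n f).symm⟩

/-- The coefficientwise quotient of a form by `n` (meaningful for multiples of `n`). [folklore] -/
def divBy (n : ℤ) (g : BinaryCubic ℤ) : BinaryCubic ℤ :=
  ⟨g.a / n, g.b / n, g.c / n, g.d / n⟩

/-- A multiple of `n` is `n` times its quotient. [folklore] -/
theorem eq_smul_divBy {n : ℤ} {g : BinaryCubic ℤ} (h : g.IsMultiple n) : g = n • g.divBy n := by
  obtain ⟨ha, hb, hc, hd⟩ := h
  exact BinaryCubic.ext (Int.mul_ediv_cancel' ha).symm (Int.mul_ediv_cancel' hb).symm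
    (Int.mul_ediv_cancel' hc).symm (Int.mul_ediv_cancel' hd).symm

/-- **Maximality at `ℓ` passes to overrings**: if `R(f) ↪ R(g)` and `f ∈ U_ℓ` then `g ∈ U_ℓ` (an
overring of `R(g)` of index divisible by `ℓ` would be one of `R(f)`, `LocalMaximality`). [folklore] -/
theorem MemU.of_injective {ℓ : ℕ} (hℓ : ℓ.Prime) {f g : BinaryCubic ℤ} (φ : RingOfForm f →+* RingOfForm g)
    (hφ : Function.Injective φ) (hf : f.MemU ℓ) : g.MemU ℓ := by
  rw [memU_iff_forall_not_dvd_detOnQuot hℓ] at hf ⊢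
  intro h ψ hψ hdvd
  exact hf h (ψ.comp φ) (hψ.comp hφ) (by rw [detOnQuot_comp]; exact Dvd.dvd.mul_left hdvd _)

end BinaryCubic

/-- A representative of a set of forms that is a `GL₂(ℤ)`-orbit (Hilbert `ε`; junk otherwise). [folklore] -/
def repOf (O : Set (BinaryCubic ℤ)) : BinaryCubic ℤ :=
  @Classical.epsilon _ ⟨⟨0, 0, 0, 0⟩⟩ fun f => O = gl2zOrbit f

/-- The representative represents. [folklore] -/
theorem eq_gl2zOrbit_repOf {O : Set (BinaryCubic ℤ)} (h : ∃ f : BinaryCubic ℤ, O = gl2zOrbit f) :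
    O = gl2zOrbit (repOf O) :=
  Classical.epsilon_spec h

/-- Every form is equivalent to the representative of its orbit. [folklore] -/
theorem gl2zEquiv_repOf (f : BinaryCubic ℤ) : GL2ZEquiv f (repOf (gl2zOrbit f)) :=
  gl2zOrbit_eq_iff.mp (eq_gl2zOrbit_repOf ⟨f, rfl⟩)

/-- The orbits of forms whose ring embeds with index `p` into `R(k)`. [folklore] -/
def indexPOrbits (k : BinaryCubic ℤ) (p : ℕ) : Set (Set (BinaryCubic ℤ)) :=
  {O | ∃ (f : BinaryCubic ℤ) (φ : RingOfForm f →+* RingOfForm k),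
    O = gl2zOrbit f ∧ Function.Injective φ ∧ (detOnQuot φ).natAbs = p}

/-- The image in `R(k)` of (an `ε`-chosen index-`p` embedding of the ring of) an orbit of `indexPOrbits k p`. [folklore] -/
def imageIn (k : BinaryCubic ℤ) (p : ℕ) (O : Set (BinaryCubic ℤ)) : Set (RingOfForm k) :=
  Classical.epsilon fun H => ∃ (f : BinaryCubic ℤ) (φ : RingOfForm f →+* RingOfForm k),
    O = gl2zOrbit f ∧ Function.Injective φ ∧ (detOnQuot φ).natAbs = p ∧ H = Set.range φ

/-- The defining property of `imageIn` on `indexPOrbits k p`. [folklore] -/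
theorem imageIn_spec {k : BinaryCubic ℤ} {p : ℕ} {O : Set (BinaryCubic ℤ)} (hO : O ∈ indexPOrbits k p) :
    ∃ (f : BinaryCubic ℤ) (φ : RingOfForm f →+* RingOfForm k),
      O = gl2zOrbit f ∧ Function.Injective φ ∧ (detOnQuot φ).natAbs = p ∧ imageIn k p O = Set.range φ := by
  obtain ⟨f, φ, hO, hφ, hdet⟩ := hO
  exact Classical.epsilon_spec (p := fun H => ∃ (f : BinaryCubic ℤ) (φ : RingOfForm f →+* RingOfForm k),
    O = gl2zOrbit f ∧ Function.Injective φ ∧ (detOnQuot φ).natAbs = p ∧ H = Set.range φ) ⟨_, f, φ, hO, hφ, hdet, rfl⟩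

/-- The image of an orbit of `indexPOrbits k p` is an index-`p` subring of `R(k)`. [folklore] -/
theorem mapsTo_imageIn (k : BinaryCubic ℤ) (p : ℕ) : Set.MapsTo (imageIn k p) (indexPOrbits k p) (indexPImages k p) :=
  fun O hO => by obtain ⟨f, φ, -, hφ, hdet, h⟩ := imageIn_spec hO; exact ⟨f, φ, hφ, hdet, h⟩

/-- **Equal images give equal orbits** (equal images are isomorphic rings,
`nonempty_ringEquiv_of_range_eq`, hence equivalent forms). [folklore] -/
theorem injOn_imageIn (k : BinaryCubic ℤ) (p : ℕ) : Set.InjOn (imageIn k p) (indexPOrbits k p) := by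
  intro O₁ h₁ O₂ h₂ h12
  obtain ⟨f₁, φ₁, hO₁, hφ₁, -, h₁⟩ := imageIn_spec h₁
  obtain ⟨f₂, φ₂, hO₂, hφ₂, -, h₂⟩ := imageIn_spec h₂
  rw [h₁, h₂] at h12
  obtain ⟨e⟩ := nonempty_ringEquiv_of_range_eq hφ₁ hφ₂ h12
  rw [hO₁, hO₂]
  exact gl2zOrbit_eq_iff.mpr (GL2ZEquiv.of_ringEquiv e)

/-- **There are at most as many isomorphism classes of index-`p` subrings of `R(k)` as index-`p`
subrings**: `#indexPOrbits k p ≤ #indexPImages k p` (so `≤ 3` if `p ∤ ct(k)`, `≤ p + 1` always). [folklore] -/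
theorem ncard_indexPOrbits_le (k : BinaryCubic ℤ) (p : ℕ) [Fact p.Prime] :
    (indexPOrbits k p).ncard ≤ (indexPImages k p).ncard :=
  Set.ncard_le_ncard_of_injOn _ (mapsTo_imageIn k p) (injOn_imageIn k p) (indexPImages_finite k p)

/-- A form whose ring embeds with index `p` into a ring isomorphic to `R(k)` gives an element of
`indexPOrbits k p`. [folklore] -/
theorem mem_indexPOrbits_of_gl2zEquiv {f g k : BinaryCubic ℤ} {p : ℕ} (φ : RingOfForm f →+* RingOfForm g)
    (hφ : Function.Injective φ) (hdet : (detOnQuot φ).natAbs = p) (hgk : GL2ZEquiv g k) :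
    gl2zOrbit f ∈ indexPOrbits k p := by
  obtain ⟨e⟩ := nonempty_ringEquiv_of_gl2zEquiv hgk.symm
  refine ⟨f, e.toRingHom.comp φ, rfl, ?_, by rw [detOnQuot_comp, Int.natAbs_mul, hdet, natAbs_detOnQuot_ringEquiv, mul_one]⟩
  exact e.injective.comp hφ

/-! ### Orbits in a discriminant window with local conditions -/

/-- `0 < s·D < Y` (real bound `Y`; `s = ±1` in the applications). [folklore] -/
def InWindow (s : ℤ) (Y : ℝ) (D : ℤ) : Prop :=
  0 < s * D ∧ ((s * D : ℤ) : ℝ) < Y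

/-- **The orbit family**: `GL₂(ℤ)`-orbits of integral binary cubic forms `f` with `0 < s·Disc f < Y`,
`m² ∣ Disc f`, and `f ∈ U_ℓ` (ring maximal at `ℓ`) for every `ℓ ∈ B`. [folklore] -/
def maxOrbits (B : Finset ℕ) (s : ℤ) (Y : ℝ) (m : ℕ) : Set (Set (BinaryCubic ℤ)) :=
  {O | ∃ f : BinaryCubic ℤ, O = gl2zOrbit f ∧ InWindow s Y f.disc ∧ ((m : ℕ) : ℤ) ^ 2 ∣ f.disc ∧
    ∀ ℓ ∈ B, f.MemU ℓ}

/-- The members of the family that are NOT maximal at `p`. [folklore] -/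
def nonmaxOrbits (B : Finset ℕ) (s : ℤ) (Y : ℝ) (m p : ℕ) : Set (Set (BinaryCubic ℤ)) :=
  maxOrbits B s Y m \ maxOrbits (insert p B) s Y m

/-- Imposing maximality at one more prime shrinks the family. [folklore] -/
theorem maxOrbits_insert_subset (B : Finset ℕ) (s : ℤ) (Y : ℝ) (m p : ℕ) :
    maxOrbits (insert p B) s Y m ⊆ maxOrbits B s Y m :=
  fun _ ⟨f, hO, hw, hm, hB⟩ => ⟨f, hO, hw, hm, fun ℓ hℓ => hB ℓ (Finset.mem_insert_of_mem hℓ)⟩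

/-- Orbits with discriminant in a window form a finite set: inside the finite union of the finite
`orbitsOfDisc D`, `0 < |D| ≤ ⌈Y⌉₊` (`|D| ≤ |s|·|D| = s·D < Y`). [folklore] -/
theorem finite_setOf_inWindow (s : ℤ) (Y : ℝ) :
    {O : Set (BinaryCubic ℤ) | ∃ f, O = gl2zOrbit f ∧ InWindow s Y f.disc}.Finite := by
  refine ((((Finset.Icc (-(⌈Y⌉₊ : ℤ)) ⌈Y⌉₊).erase 0).finite_toSet.biUnion fun D hD =>
    orbitsOfDisc_finite (Finset.mem_erase.mp hD).1).subset ?_)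
  rintro O ⟨f, rfl, h0, hY⟩
  have hs0 : s ≠ 0 := by rintro rfl; rw [zero_mul] at h0; exact lt_irrefl _ h0
  have hD0 : f.disc ≠ 0 := by rintro h; rw [h, mul_zero] at h0; exact lt_irrefl _ h0
  have hsD : ((s * f.disc : ℤ) : ℝ) < ((⌈Y⌉₊ : ℤ) : ℝ) := by rw [Int.cast_natCast]; exact hY.trans_le (Nat.le_ceil Y)
  have habs : |f.disc| ≤ (⌈Y⌉₊ : ℤ) :=
    calc |f.disc| = 1 * |f.disc| := (one_mul _).symm
      _ ≤ |s| * |f.disc| := mul_le_mul_of_nonneg_right (Int.one_le_abs hs0) (abs_nonneg _)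
      _ = s * f.disc := by rw [← abs_mul, abs_of_pos h0]
      _ ≤ ⌈Y⌉₊ := (Int.cast_lt.mp hsD).le
  simp only [Set.mem_iUnion, Finset.mem_coe, Finset.mem_erase, Finset.mem_Icc]
  exact ⟨f.disc, ⟨hD0, abs_le.mp habs⟩, f, rfl, rfl⟩

/-- The orbit family is finite. [folklore] -/
theorem maxOrbits_finite (B : Finset ℕ) (s : ℤ) (Y : ℝ) (m : ℕ) : (maxOrbits B s Y m).Finite :=
  (finite_setOf_inWindow s Y).subset fun _ ⟨f, hO, hw, _⟩ => ⟨f, hO, hw⟩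

/-- **Splitting by maximality at `p`**: `#maxOrbits B = #maxOrbits (insert p B) + #nonmaxOrbits B … p`. [folklore] -/
theorem ncard_maxOrbits_eq_add (B : Finset ℕ) (s : ℤ) (Y : ℝ) (m p : ℕ) :
    (maxOrbits B s Y m).ncard = (maxOrbits (insert p B) s Y m).ncard + (nonmaxOrbits B s Y m p).ncard := by
  rw [nonmaxOrbits, add_comm, Set.ncard_sdiff_add_ncard_of_subset (maxOrbits_insert_subset B s Y m p)
    (maxOrbits_finite B s Y m)]

/-! ### The overring step -/

/-- Double counting with fibres of bounded size, for finite sets. [folklore] -/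
theorem ncard_le_mul_ncard_of_fibre {α β : Type*} {S : Set α} {T : Set β} (hS : S.Finite) (hT : T.Finite)
    (ψ : α → β) (hmaps : ∀ a ∈ S, ψ a ∈ T) (n : ℕ) (hfib : ∀ b ∈ T, {a ∈ S | ψ a = b}.ncard ≤ n) :
    S.ncard ≤ n * T.ncard := by
  classical
  rw [Set.ncard_eq_toFinset_card S hS, Set.ncard_eq_toFinset_card T hT]
  refine Finset.card_le_mul_card_image_of_maps_to (f := ψ) (fun a ha => ?_) n (fun b hb => ?_)
  · exact (Set.Finite.mem_toFinset hT).mpr (hmaps a ((Set.Finite.mem_toFinset hS).mp ha))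
  · calc (hS.toFinset.filter (fun a => ψ a = b)).card
          = ((hS.toFinset.filter (fun a => ψ a = b) : Finset α) : Set α).ncard := (Set.ncard_coe_finset _).symm
      _ = {a ∈ S | ψ a = b}.ncard := by rw [Finset.coe_filter]; simp only [Set.Finite.mem_toFinset]
      _ ≤ n := hfib b ((Set.Finite.mem_toFinset hT).mp hb)

section Step

variable {B : Finset ℕ} {s : ℤ} {Y : ℝ} {m : ℕ} (p : ℕ)

/-- Passing from `Disc = c · Disc'` (`c > 0`) to the window `Y/c`. [folklore] -/
theorem inWindow_div {c : ℕ} (hc : 0 < c) {D D' : ℤ} (h : D = (c : ℤ) * D') (hw : InWindow s Y D) :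
    InWindow s (Y / (c : ℝ)) D' := by
  obtain ⟨h0, hY⟩ := hw
  have hcr : (0 : ℝ) < (c : ℝ) := by exact_mod_cast hc
  rw [h, mul_left_comm] at h0 hY
  refine ⟨pos_of_mul_pos_right h0 (by exact_mod_cast hc.le), ?_⟩
  rw [lt_div_iff₀ hcr, mul_comm]
  exact_mod_cast hY

/-- Square divisors prime to `p` survive division of the discriminant by a power of `p`. [folklore] -/
theorem sq_dvd_of_coprime (hpm : p.Coprime m) {j : ℕ} {D' : ℤ} (h : ((p * m : ℕ) : ℤ) ^ 2 ∣ (p : ℤ) ^ j * D') :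
    ((m : ℕ) : ℤ) ^ 2 ∣ D' := by
  exact ((Nat.Coprime.isCoprime hpm.symm).pow).dvd_of_dvd_mul_left
    ((Dvd.intro_left ((p : ℤ) ^ 2) (by push_cast; ring)).trans h)

/-- The conditions of `nonmaxOrbits` hold for the representative. [folklore] -/
theorem repOf_of_mem_nonmaxOrbits {O : Set (BinaryCubic ℤ)} (hO : O ∈ nonmaxOrbits B s Y m p) :
    O = gl2zOrbit (repOf O) ∧ InWindow s Y (repOf O).disc ∧ ((m : ℕ) : ℤ) ^ 2 ∣ (repOf O).disc ∧
      (∀ ℓ ∈ B, (repOf O).MemU ℓ) ∧ ¬ (repOf O).MemU p := by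
  obtain ⟨⟨f, hO', hw, hm, hB⟩, hO2⟩ := hO
  have he : GL2ZEquiv f (repOf O) := by
    have := gl2zEquiv_repOf f; rwa [← hO'] at this
  rw [show (repOf O).disc = f.disc from he.disc_eq]
  refine ⟨eq_gl2zOrbit_repOf ⟨f, hO'⟩, hw, hm, fun ℓ hℓ => (hB ℓ hℓ).of_gl2zEquiv he, fun h => hO2 ⟨f, hO', hw, hm, ?_⟩⟩
  intro ℓ hℓ
  rcases Finset.mem_insert.mp hℓ with rfl | hℓ
  exacts [h.of_gl2zEquiv he.symm, hB ℓ hℓ]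

/-- An `ε`-chosen form whose ring contains `R(repOf O)` with index `p` — an index-`p` overring, which exists
when `repOf O` is nonmaximal at `p` with content prime to `p` (BTT Lemma 2.3 (i), `exists_overring_index_eq`). [folklore] -/
def overOf (O : Set (BinaryCubic ℤ)) : BinaryCubic ℤ :=
  @Classical.epsilon _ ⟨⟨0, 0, 0, 0⟩⟩ fun g => ∃ φ : RingOfForm (repOf O) →+* RingOfForm g,
    Function.Injective φ ∧ (detOnQuot φ).natAbs = p

/-- The overring form comes with an embedding `R(repOf O) ↪ R(overOf p O)` of index `p`. [folklore] -/
theorem overOf_spec [hp : Fact p.Prime] {O : Set (BinaryCubic ℤ)} (h1 : ¬ (repOf O).MemU p) (h2 : ¬ (repOf O).IsMultiple p) :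
    ∃ φ : RingOfForm (repOf O) →+* RingOfForm (overOf p O), Function.Injective φ ∧ (detOnQuot φ).natAbs = p :=
  Classical.epsilon_spec (exists_overring_index_eq (f := repOf O) hp.out.one_lt h1 h2)

/-- Passing to a form `g'` with `Disc(repOf O) = p^k · Disc g'` to which maximality at `B` transfers: its orbit
lies in the family at `Y/p^k` (window, `m² ∣ Disc` by coprimality, maximality). [folklore] -/
theorem mem_maxOrbits_div [hp : Fact p.Prime] (hpm : p.Coprime m) {O : Set (BinaryCubic ℤ)}
    (hO : O ∈ nonmaxOrbits B s Y (p * m) p) {k : ℕ} {g' : BinaryCubic ℤ}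
    (hdisc : (repOf O).disc = ((p ^ k : ℕ) : ℤ) * g'.disc) (hU : ∀ ℓ ∈ B, (repOf O).MemU ℓ → g'.MemU ℓ) :
    gl2zOrbit g' ∈ maxOrbits B s (Y / (p : ℝ) ^ k) m := by
  obtain ⟨-, hw, hm, hBO, -⟩ := repOf_of_mem_nonmaxOrbits p hO
  refine ⟨g', rfl, ?_, ?_, fun ℓ hℓ => hU ℓ hℓ (hBO ℓ hℓ)⟩
  · have := inWindow_div (pow_pos hp.out.pos k) hdisc hw
    rwa [Nat.cast_pow] at this
  · refine sq_dvd_of_coprime p hpm (j := k) ?_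
    rw [hdisc, Nat.cast_pow] at hm
    exact hm

/-- **Case `p ∣ ct`**: `O ↦ orbit(repOf O / p)` maps into the family at `Y/p⁴` (`Disc(p g) = p⁴ Disc g`). [folklore] -/
theorem mapsTo_case_multiple [hp : Fact p.Prime] (hB : ∀ ℓ ∈ B, ℓ.Prime) (hpm : p.Coprime m) :
    ∀ O ∈ {O ∈ nonmaxOrbits B s Y (p * m) p | (repOf O).IsMultiple p},
      gl2zOrbit ((repOf O).divBy p) ∈ maxOrbits B s (Y / (p : ℝ) ^ 4) m := by
  rintro O ⟨hO, hmul⟩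
  have hf : repOf O = (p : ℤ) • (repOf O).divBy p := eq_smul_divBy hmul
  refine mem_maxOrbits_div p hpm hO (by rw [hf, disc_smul, ← hf]; push_cast; ring) fun ℓ hℓ h => ?_
  exact (hf ▸ h).of_injective (hB ℓ hℓ) (ofMultiple _ _) (ofMultiple_injective (by exact_mod_cast hp.out.ne_zero) _)

/-- **Case `p ∣ ct`**: the map is injective (`f = p · (f/p)` and scaling commutes with the action). [folklore] -/
theorem injOn_case_multiple :
    Set.InjOn (fun O => gl2zOrbit ((repOf O).divBy p)) {O ∈ nonmaxOrbits B s Y (p * m) p | (repOf O).IsMultiple p} := by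
  rintro O₁ ⟨hO₁, hm₁⟩ O₂ ⟨hO₂, hm₂⟩ h
  have h' : GL2ZEquiv ((repOf O₁).divBy p) ((repOf O₂).divBy p) := gl2zOrbit_eq_iff.mp h
  have h'' := h'.smul (p : ℤ)
  rw [← eq_smul_divBy hm₁, ← eq_smul_divBy hm₂] at h''
  exact (repOf_of_mem_nonmaxOrbits p hO₁).1.trans
    ((gl2zOrbit_eq_iff.mpr h'').trans (repOf_of_mem_nonmaxOrbits p hO₂).1.symm)

/-- **Case `p ∤ ct`, overring primitive at `p`**: `O ↦ orbit(overOf p O)` maps into the family at `Y/p²`. [folklore] -/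
theorem mapsTo_case_prim [hp : Fact p.Prime] (hB : ∀ ℓ ∈ B, ℓ.Prime) (hpm : p.Coprime m) :
    ∀ O ∈ {O ∈ nonmaxOrbits B s Y (p * m) p | ¬ (repOf O).IsMultiple p ∧ ¬ (overOf p O).IsMultiple p},
      gl2zOrbit (overOf p O) ∈ maxOrbits B s (Y / (p : ℝ) ^ 2) m := by
  rintro O ⟨hO, hmul, -⟩
  obtain ⟨φ, hφ, hdet⟩ := overOf_spec p (repOf_of_mem_nonmaxOrbits p hO).2.2.2.2 hmul
  refine mem_maxOrbits_div p hpm hO (k := 2) ?_ fun ℓ hℓ h => h.of_injective (hB ℓ hℓ) φ hφ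
  rw [disc_eq_detOnQuot_sq_mul φ hφ, ← Int.natAbs_sq (detOnQuot φ), hdet, Nat.cast_pow]

/-- **Case `p ∤ ct`, overring primitive at `p`: fibres have at most `3` elements** (an orbit in the
fibre over `b = orbit(k)` is the class of an index-`p` subring of `R(k)`, `p ∤ ct(k)`). [folklore] -/
theorem fibre_case_prim [hp : Fact p.Prime] {b : Set (BinaryCubic ℤ)} (hb : b ∈ maxOrbits B s (Y / (p : ℝ) ^ 2) m) :
    {O ∈ {O ∈ nonmaxOrbits B s Y (p * m) p | ¬ (repOf O).IsMultiple p ∧ ¬ (overOf p O).IsMultiple p} |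
      gl2zOrbit (overOf p O) = b}.ncard ≤ 3 := by
  set F := {O ∈ {O ∈ nonmaxOrbits B s Y (p * m) p | ¬ (repOf O).IsMultiple p ∧ ¬ (overOf p O).IsMultiple p} |
      gl2zOrbit (overOf p O) = b}
  rcases F.eq_empty_or_nonempty with hF | ⟨O₀, hO₀⟩
  · rw [hF, Set.ncard_empty]; exact Nat.zero_le _
  have hbk : b = gl2zOrbit (repOf b) := eq_gl2zOrbit_repOf (hb.imp fun _ h => h.1)
  have hequiv : ∀ O ∈ F, GL2ZEquiv (overOf p O) (repOf b) := fun O hO =>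
    gl2zOrbit_eq_iff.mp (hO.2.trans hbk)
  have hk : ¬ (repOf b).IsMultiple p := fun h => hO₀.1.2.2 (h.of_gl2zEquiv (hequiv O₀ hO₀).symm)
  calc F.ncard ≤ (indexPOrbits (repOf b) p).ncard := Set.ncard_le_ncard (fun O hO => ?_) (Set.Finite.of_injOn (mapsTo_imageIn _ p) (injOn_imageIn _ p) (indexPImages_finite _ p))
    _ ≤ (indexPImages (repOf b) p).ncard := ncard_indexPOrbits_le _ p
    _ ≤ 3 := ncard_indexPImages_le_three hk
  obtain ⟨hrep, -, -, -, hp'⟩ := repOf_of_mem_nonmaxOrbits p hO.1.1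
  obtain ⟨φ, hφ, hdet⟩ := overOf_spec p hp' hO.1.2.1
  exact hrep ▸ mem_indexPOrbits_of_gl2zEquiv φ hφ hdet (hequiv O hO)

/-- **Case `p ∤ ct`, overring `ℤ + pS`**: `O ↦ orbit(S) = orbit(overOf p O / p)` maps into the family
at `Y/p⁶`. [folklore] -/
theorem mapsTo_case_imprim [hp : Fact p.Prime] (hB : ∀ ℓ ∈ B, ℓ.Prime) (hpm : p.Coprime m) :
    ∀ O ∈ {O ∈ nonmaxOrbits B s Y (p * m) p | ¬ (repOf O).IsMultiple p ∧ (overOf p O).IsMultiple p},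
      gl2zOrbit ((overOf p O).divBy p) ∈ maxOrbits B s (Y / (p : ℝ) ^ 6) m := by
  rintro O ⟨hO, hnm, hmul⟩
  obtain ⟨φ, hφ, hdet⟩ := overOf_spec p (repOf_of_mem_nonmaxOrbits p hO).2.2.2.2 hnm
  have hg : overOf p O = (p : ℤ) • (overOf p O).divBy p := eq_smul_divBy hmul
  refine mem_maxOrbits_div p hpm hO (k := 6) ?_ fun ℓ hℓ h => ?_
  · rw [disc_eq_detOnQuot_sq_mul φ hφ, ← Int.natAbs_sq (detOnQuot φ), hdet, hg, disc_smul, ← hg]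
    push_cast; ring
  · exact (hg ▸ h.of_injective (hB ℓ hℓ) φ hφ).of_injective (hB ℓ hℓ) (ofMultiple _ _)
      (ofMultiple_injective (by exact_mod_cast hp.out.ne_zero) _)

/-- **Case `p ∤ ct`, overring `ℤ + pS`: fibres have at most `p + 1` elements** (an orbit in the fibre
over `b = orbit(k)` is the class of an index-`p` subring of `R(p · k)`). [folklore] -/
theorem fibre_case_imprim [hp : Fact p.Prime] {b : Set (BinaryCubic ℤ)} (hb : b ∈ maxOrbits B s (Y / (p : ℝ) ^ 6) m) :
    {O ∈ {O ∈ nonmaxOrbits B s Y (p * m) p | ¬ (repOf O).IsMultiple p ∧ (overOf p O).IsMultiple p} |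
      gl2zOrbit ((overOf p O).divBy p) = b}.ncard ≤ p + 1 := by
  set F := {O ∈ {O ∈ nonmaxOrbits B s Y (p * m) p | ¬ (repOf O).IsMultiple p ∧ (overOf p O).IsMultiple p} |
      gl2zOrbit ((overOf p O).divBy p) = b}
  have hbk : b = gl2zOrbit (repOf b) := eq_gl2zOrbit_repOf (hb.imp fun _ h => h.1)
  have hequiv : ∀ O ∈ F, GL2ZEquiv (overOf p O) ((p : ℤ) • repOf b) := fun O hO => by
    have h := (gl2zOrbit_eq_iff.mp (hO.2.trans hbk)).smul (p : ℤ)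
    rwa [← eq_smul_divBy hO.1.2.2] at h
  calc F.ncard ≤ (indexPOrbits ((p : ℤ) • repOf b) p).ncard :=
        Set.ncard_le_ncard (fun O hO => ?_) (Set.Finite.of_injOn (mapsTo_imageIn _ p) (injOn_imageIn _ p) (indexPImages_finite _ p))
    _ ≤ (indexPImages ((p : ℤ) • repOf b) p).ncard := ncard_indexPOrbits_le _ p
    _ ≤ p + 1 := ncard_indexPImages_le_succ _ p
  obtain ⟨hrep, -, -, -, hp'⟩ := repOf_of_mem_nonmaxOrbits p hO.1.1
  obtain ⟨φ, hφ, hdet⟩ := overOf_spec p hp' hO.1.2.1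
  exact hrep ▸ mem_indexPOrbits_of_gl2zEquiv φ hφ hdet (hequiv O hO)

/-- Counting a finite set covered by three of its subsets. [folklore] -/
theorem ncard_le_of_subset_union₃ {α : Type*} {S : Set α} (S₁ S₂ S₃ : Set α) (hS : S.Finite) (h₁ : S₁ ⊆ S)
    (h₂ : S₂ ⊆ S) (h₃ : S₃ ⊆ S) (h : S ⊆ S₁ ∪ S₂ ∪ S₃) : S.ncard ≤ S₁.ncard + S₂.ncard + S₃.ncard :=
  (Set.ncard_le_ncard h (((hS.subset h₁).union (hS.subset h₂)).union (hS.subset h₃))).trans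
    ((Set.ncard_union_le _ _).trans (Nat.add_le_add_right (Set.ncard_union_le _ _) _))

/-- **The overring step** (BST Prop. 23, `𝒲_p`; BTT Lemma 2.3): in the family of orbits with
`0 < s·Disc < Y`, `(pm)² ∣ Disc` (`p ∤ m`), maximal at the primes of `B`, those NONmaximal at `p` number
at most `3·N(Y/p²) + (p+1)·N(Y/p⁶) + N(Y/p⁴)`, where `N(Z) = #maxOrbits B s Z m`. [cite: BhargavaShankarTsimerman2012, Proposition 23 (proof, the set 𝒲_p: O(X/p²) + O((p+1)X/p⁶) + O(X/p⁴))] -/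
theorem ncard_nonmaxOrbits_le [hp : Fact p.Prime] (hB : ∀ ℓ ∈ B, ℓ.Prime) (hpm : p.Coprime m) :
    (nonmaxOrbits B s Y (p * m) p).ncard ≤
      3 * (maxOrbits B s (Y / (p : ℝ) ^ 2) m).ncard + (p + 1) * (maxOrbits B s (Y / (p : ℝ) ^ 6) m).ncard +
        (maxOrbits B s (Y / (p : ℝ) ^ 4) m).ncard := by
  have hfin : (nonmaxOrbits B s Y (p * m) p).Finite := (maxOrbits_finite B s Y (p * m)).sdiff
  refine (ncard_le_of_subset_union₃
    {O ∈ nonmaxOrbits B s Y (p * m) p | ¬ (repOf O).IsMultiple p ∧ ¬ (overOf p O).IsMultiple p}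
    {O ∈ nonmaxOrbits B s Y (p * m) p | ¬ (repOf O).IsMultiple p ∧ (overOf p O).IsMultiple p}
    {O ∈ nonmaxOrbits B s Y (p * m) p | (repOf O).IsMultiple p} hfin (Set.sep_subset _ _) (Set.sep_subset _ _)
    (Set.sep_subset _ _) fun O hO => ?_).trans (Nat.add_le_add (Nat.add_le_add ?_ ?_) ?_)
  · by_cases h2 : (repOf O).IsMultiple p
    · exact Or.inr ⟨hO, h2⟩
    · by_cases h3 : (overOf p O).IsMultiple p
      · exact Or.inl (Or.inr ⟨hO, h2, h3⟩)
      · exact Or.inl (Or.inl ⟨hO, h2, h3⟩)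
  · exact ncard_le_mul_ncard_of_fibre (hfin.subset (Set.sep_subset _ _)) (maxOrbits_finite _ _ _ _) _
      (mapsTo_case_prim p hB hpm) 3 (fun b hb => fibre_case_prim p hb)
  · exact ncard_le_mul_ncard_of_fibre (hfin.subset (Set.sep_subset _ _)) (maxOrbits_finite _ _ _ _) _
      (mapsTo_case_imprim p hB hpm) (p + 1) (fun b hb => fibre_case_imprim p hb)
  · exact Set.ncard_le_ncard_of_injOn _ (mapsTo_case_multiple p hB hpm) (injOn_case_multiple p)
      (maxOrbits_finite _ _ _ _)

end Step

/-! ### The per-prime factor and the maximal-part hypothesis (the input shape of the induction) -/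

/-- The factor at the prime `p` in the induction, `c + 3 + 1/p² + (p+1)/p⁴` (`c`: maximal at `p`; `3`: index-`p`
subrings, `p ∤ ct`; `1/p²`: content `p`; `(p+1)/p⁴`: overring of content `p`). [folklore] -/
def stepFactor (c : ℝ) (p : ℕ) : ℝ :=
  c + 3 + 1 / (p : ℝ) ^ 2 + ((p : ℝ) + 1) / (p : ℝ) ^ 4

/-- **The maximal part of the uniformity count, with constants `(c, C)`** — the input SHAPE of
`btt_uniformity_sqDvd_of_maximalPartBound` (a predicate; nothing is asserted): for every finite set `B` of
primes (`b = ∏ B`), `s = ±1` and `X ∈ ℕ`, the `GL₂(ℤ)`-orbits of integral binary cubic forms `f` with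
`0 < s·Disc f < X`, `b² ∣ Disc f` and `R(f)` maximal at every prime of `b` (for odd `ℓ ∣ b`: `ℓ` totally
ramified) number at most `C · c^{#B} · X / b²` — the part of BTT Prop. 4.5 that [DH, §5], [BBP, §3] bound by
reduction theory; Prop. 4.5 gives it back with `c = 6` (`maximalPartBound_of_btt_uniformity_sqDvd`). [folklore] -/
def MaximalPartBound (c C : ℝ) : Prop :=
  ∀ B : Finset ℕ, (∀ ℓ ∈ B, ℓ.Prime) → ∀ s : ℤ, (s = 1 ∨ s = -1) → ∀ X : ℕ,
    ((maxOrbits B s X (∏ ℓ ∈ B, ℓ)).ncard : ℝ) ≤ C * c ^ B.card * X / ((∏ ℓ ∈ B, ℓ : ℕ) : ℝ) ^ 2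

end Literature.NumberTheory.CubicFields

end
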